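import Literature.MathematicalPhysics.QuantumFieldTheory.Balaban1983to89.B6GaussianIdentity2119
import Literature.MathematicalPhysics.QuantumFieldTheory.Balaban1983to89.B6Eq2130

/-!
# `Balaban1983to89.B6Repr2129` — T. Bałaban, *Propagators and renormalization transformations for lattice gauge
# theories. II*, Commun. Math. Phys. **96** (1984) 223–250 [Balaban1984PropagatorsII], Sect. C (2.129) p. 246: the
# two-scale representation `⟨J,GJ⟩ = ⟨J,∂H′_jC^{(j)}_ΛH′_j*∂*J⟩ + ⟨J − ∂ΔH′_jCH′_j*∂*J,(G̃_j + H_jC̃^{(j)}_ΛH_j*)(J − …)⟩`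
# PROVED from (2.119) (hence from (2.112)) by calculating the Gaussian integral in (2.119), with the covariance bound of p. 246

statement-level skeleton of published theorems with citation tags; proofs where landed; nothing here is a claim about the Yang–Mills mass gap

PDF held: `paper:balaban1984-cmp96-propagators-rt-ii` (journal page = PDF page + 222); read AS IMAGES on the ×2 renders
`run/shared/lean/pub/pub-balaban/b2b-balaban-ref1/pages/1984-cmp96-propagators-rt-II/…-p018 … -p024-x2.png` (pp. 240–246)
by this seat (2026-08-21).

CITATION HEADER (lean-in-tree rule).  WHAT IS REPRODUCED: lit-balaban SKELETON row **B6.Eq2.129** (until now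
`typed-existing` NAMED ONLY — the opaque field `…B6.LocalOp.Repr2129 : Prop`) and the covariance sentence of row
**B6.Txt@246**; part 2/2 of PHASE-2 seat p22 (gen 2) (part 1/2 = `…B6Eq2130`: the printed `H_j` (2.130), `G̃_j` (2.131)
discharge the hypotheses `hcrit`/`hsol`); owner r03, referee ref-4.  CONTINUES `…B6GaussianIdentity2119` ((2.119), seat
p22 gen 1) and `…B6Eq295` §4 ((2.113)–(2.116), r03): same abstract carriers and conventions (δ-function integrals =
integrals over a parameter space of the constraint surface against a left-invariant measure; *"a covariance of this
Gaussian integral"* = an operator ranging in the constraint subspace and inverting the form there; no integrability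
hypothesis — none is needed: (2.119), displayed for every source `J`, has the non-zero left-hand side `e^{½⟨J,GJ⟩}`).
Nothing of any existing module is restated or modified; `…B6Eq295.eq2115` and `…B6GaussianIdentity2119.eq2119` are
consumed by name.

PRINT (p. 246 [PDF 24], verbatim).  *"Another consequence is a bound from below for the form (2.120), or for the form
(2.122). These forms are bounded from below by γ₀″‖B‖² with a positive constant γ₀″ dependent on d and L only. This implies
that a covariance C̃^{(j)}_Λ of the Gaussian integral in (2.119) is bounded from above by a positive constant dependent on d
and L only, and it has an exponential decay with a decay rate having the same property. We may calculate the integral in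
(2.119), and we get finally the desired identity:
⟨J, GJ⟩ = ⟨J, ∂H′_jC^{(j)}_ΛH′_j*∂*J⟩ + ⟨J − ∂ΔH′_jC^{(j)}_ΛH′_j*∂*J, (G̃_j + H_jC̃^{(j)}_ΛH_j*)(J − ∂ΔH′_jC^{(j)}_ΛH′_j*∂*J)⟩. (2.129)"*
with (2.119) p. 243: *"e^{½⟨J,GJ⟩} = exp[½⟨J, ∂H′_jC^{(j)}_ΛH′_j*∂*J⟩ + ½⟨J − ∂ΔH′_jC^{(j)}_ΛH′_j*∂*J, G̃_j(J − …)⟩]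
· Z″⁻¹∫dB Π_{y∈Λ′}δ_{Ax(y)}(B) exp[−½⟨Q″B, aQ″B⟩ − ½⟨B, Δ_jB⟩ + ⟨B, H_j*(J − ∂ΔH′_jC^{(j)}_ΛH′_j*∂*J)⟩]"*, and (2.120)–(2.121)
p. 244: the form `‖B↾_{Λ^c}‖² + L^{−2}‖(Q₁B)↾_{Λ′}‖² + ⟨B, Δ_jB⟩` *"on the configurations B satisfying B(b) = 0 for
b ⊂ Γ_{y,x}, x ∈ B(y), y ∈ Λ′"*.

WHAT IS TYPED / PROVED (no deferred proofs; every hypothesis displayed).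
§1 *"We may calculate the integral in (2.119)"*: `form_2120` / `form_2120_symm` (the quadratic form of (2.119)–(2.120)
   as one symmetric operator `Q″*aQ″ + Δ_j`), **`integral_2119`** (the B-integral of (2.119) over the configurations
   (2.121), parametrised LINEARLY by `ι_B` with a left-invariant `ν`, with source `K`: `= e^{½⟨K, C̃^{(j)}_ΛK⟩} ·` its
   value at `K = 0`, `C̃^{(j)}_Λ` = *"a covariance of the Gaussian integral in (2.119)"*, by `…B6Eq295.eq2115`).
§2 **`eq2129_of_2119`** — (2.129) AS PRINTED from (2.119) taken for every source `J` (its `J = 0` instance is the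
   normalisation `Z″⁻¹∫dB Πδ_{Ax(y)}(B)e^{−½⟨Q″B,aQ″B⟩−½⟨B,Δ_jB⟩} = 1`, `normalisation_2119`; then injectivity of `exp`);
   **`eq2129`** — (2.129) from (2.112) taken for every `J` (`…B6GaussianIdentity2119.eq2119` + `eq2129_of_2119`);
   **`eq2129_printed`** — the same with `H_j`, `G̃_j` THE printed operators (2.130)–(2.131) of `…B6Eq2130` (their
   hypotheses `hcrit`, `hsol` being theorems there).
§3 the covariance sentence: `cov_coercive`, **`norm_cov_le`**, `inner_cov_nonneg`, **`inner_cov_le`** — a form `≥ γ‖B‖²`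
   on the constraint configurations (print: `γ = γ₀″(d, L)`) has its covariances bounded: `‖C̃K‖ ≤ γ⁻¹‖K‖`,
   `0 ≤ ⟨K,C̃K⟩ ≤ γ⁻¹‖K‖²` (the exponential decay *"with a decay rate having the same property"* is the theorem of [3]
   Sect. 5 = `…B4Sect5Proof`, not re-derived here).
READINGS (none is an objection to print).  (a) As in `…B6GaussianIdentity2119`: `K₁ = ∂H′_jC^{(j)}_ΛH′_j*∂*`,
`K₂ = ∂ΔH′_jC^{(j)}_ΛH′_j*∂*` abstract linear maps, `Z″⁻¹ = Z⁻¹Z′_j⁻¹Z′·Z̃_j`; the B-integral `∫dB Π_{y∈Λ′}δ_{Ax(y)}(B)F(B)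
= ∫ F(ι_B m) dν(m)` now with `ι_B` linear and `ν` left-invariant (in (2.119) alone they were arbitrary; the Gaussian
evaluation needs the linear structure).  (b) (2.112)/(2.119) are displayed for an arbitrary source `J`; the hypotheses
`h2112`/`h2119` say so (`∀ J`), which is what makes the constants drop out at `J = 0` — print does not spell the
normalisation out.  (c) `≤`/junk conventions of `…B6Eq295`.
Unit `lit-balaban-p22` (PHASE-2 proof seat, gen 2), HOME `run/shared/lean/pub/lit-balaban/`, 2026-08-21.
-/

noncomputable section

open MeasureTheory
open scoped InnerProductSpace

namespace Literature.MathematicalPhysics.QuantumFieldTheory.Balaban1983to89.B6Repr2129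



/-! ## §1 "We may calculate the integral in (2.119)": the B-integral over the axial-gauge configurations -/

section BIntegral

variable {Bs : Type*} [NormedAddCommGroup Bs] [InnerProductSpace ℝ Bs]
variable {V : Type*} [NormedAddCommGroup V] [InnerProductSpace ℝ V]
variable {NB : Type*} [AddCommGroup NB] [Module ℝ NB] [MeasurableSpace NB] [MeasurableAdd NB]

/-- The quadratic form of the Gaussian integral in (2.119) (= (2.120) for `a = 1`), as ONE operator:
`⟨Q″B, aQ″B⟩ + ⟨B, Δ_jB⟩ = ⟨B, (Q″*aQ″ + Δ_j)B⟩`, `Q″*` the adjoint of `Q″`. [cite: Balaban1984PropagatorsII, (2.119)–(2.120) pp.243–244] -/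
theorem form_2120 (Qpp : Bs →ₗ[ℝ] V) (Qpps : V →ₗ[ℝ] Bs) (a : V →ₗ[ℝ] V) (Δj : Bs →ₗ[ℝ] Bs)
    (hQpp : ∀ (w : V) (b : Bs), ⟪Qpps w, b⟫_ℝ = ⟪w, Qpp b⟫_ℝ) (b : Bs) :
    ⟪Qpp b, a (Qpp b)⟫_ℝ + ⟪b, Δj b⟫_ℝ = ⟪b, (Qpps ∘ₗ a ∘ₗ Qpp + Δj) b⟫_ℝ := by
  have h1 : ⟪Qpp b, a (Qpp b)⟫_ℝ = ⟪b, Qpps (a (Qpp b))⟫_ℝ := by rw [real_inner_comm, ← hQpp, real_inner_comm]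
  simp only [LinearMap.add_apply, LinearMap.coe_comp, Function.comp_apply, inner_add_right, h1]

/-- That operator is symmetric (`a`, `Δ_j` symmetric, `Q″*` the adjoint of `Q″`). [cite: Balaban1984PropagatorsII, (2.119)–(2.120) pp.243–244] -/
theorem form_2120_symm (Qpp : Bs →ₗ[ℝ] V) (Qpps : V →ₗ[ℝ] Bs) (a : V →ₗ[ℝ] V) (Δj : Bs →ₗ[ℝ] Bs)
    (hQpp : ∀ (w : V) (b : Bs), ⟪Qpps w, b⟫_ℝ = ⟪w, Qpp b⟫_ℝ) (ha : ∀ x y : V, ⟪a x, y⟫_ℝ = ⟪x, a y⟫_ℝ)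
    (hΔj : ∀ x y : Bs, ⟪Δj x, y⟫_ℝ = ⟪x, Δj y⟫_ℝ) (x y : Bs) :
    ⟪(Qpps ∘ₗ a ∘ₗ Qpp + Δj) x, y⟫_ℝ = ⟪x, (Qpps ∘ₗ a ∘ₗ Qpp + Δj) y⟫_ℝ := by
  have hQpp' : ∀ (b : Bs) (w : V), ⟪b, Qpps w⟫_ℝ = ⟪Qpp b, w⟫_ℝ := fun b w => by
    rw [real_inner_comm, hQpp, real_inner_comm]
  simp only [LinearMap.add_apply, LinearMap.coe_comp, Function.comp_apply, inner_add_left, inner_add_right]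
  rw [hQpp, ha, hQpp', hΔj]

/-- **The Gaussian integral in (2.119), calculated** (*"We may calculate the integral in (2.119)"*, p. 246).  The
configurations `B` satisfying (2.121) are parametrised linearly by `ι_B : NB → B` with a left-invariant `ν`
(`∫dB Π_{y∈Λ′}δ_{Ax(y)}(B) F(B) = ∫ F(ι_B m) dν(m)`); `C̃^{(j)}_Λ` — *"a covariance of the Gaussian integral in (2.119)"* —
ranges in these configurations (`C̃ = ι_B∘T_B`) and inverts the form `Q″*aQ″ + Δ_j` there (`hCsol`).  Then for every
source `K` (in (2.119): `K = H_j*(J − ∂ΔH′_jC^{(j)}_ΛH′_j*∂*J)`)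
`∫dB Πδ_{Ax(y)}(B) e^{−½⟨Q″B,aQ″B⟩ − ½⟨B,Δ_jB⟩ + ⟨B,K⟩} = e^{½⟨K,C̃^{(j)}_ΛK⟩} · ∫dB Πδ_{Ax(y)}(B) e^{−½⟨Q″B,aQ″B⟩ − ½⟨B,Δ_jB⟩}`
(`…B6Eq295.eq2115` for the form of `form_2120`).  No integrability hypothesis. [cite: Balaban1984PropagatorsII, (2.119) p.243 + (2.129) p.246] -/
theorem integral_2119 (ν : Measure NB) [ν.IsAddLeftInvariant] (ιB : NB →ₗ[ℝ] Bs) (TB : Bs →ₗ[ℝ] NB)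
    (Qpp : Bs →ₗ[ℝ] V) (Qpps : V →ₗ[ℝ] Bs) (a : V →ₗ[ℝ] V) (Δj Ct : Bs →ₗ[ℝ] Bs)
    (hQpp : ∀ (w : V) (b : Bs), ⟪Qpps w, b⟫_ℝ = ⟪w, Qpp b⟫_ℝ) (ha : ∀ x y : V, ⟪a x, y⟫_ℝ = ⟪x, a y⟫_ℝ)
    (hΔj : ∀ x y : Bs, ⟪Δj x, y⟫_ℝ = ⟪x, Δj y⟫_ℝ) (hCt : ∀ K, Ct K = ιB (TB K))
    (hCsol : ∀ (m : NB) (K : Bs), ⟪ιB m, (Qpps ∘ₗ a ∘ₗ Qpp + Δj) (Ct K)⟫_ℝ = ⟪ιB m, K⟫_ℝ) (K : Bs) :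
    ∫ m, Real.exp (-(1 / 2) * ⟪Qpp (ιB m), a (Qpp (ιB m))⟫_ℝ - (1 / 2) * ⟪ιB m, Δj (ιB m)⟫_ℝ
        + ⟪ιB m, K⟫_ℝ) ∂ν =
      Real.exp ((1 / 2) * ⟪K, Ct K⟫_ℝ) *
        ∫ m, Real.exp (-(1 / 2) * ⟪Qpp (ιB m), a (Qpp (ιB m))⟫_ℝ - (1 / 2) * ⟪ιB m, Δj (ιB m)⟫_ℝ) ∂ν := by
  have hpt : ∀ b : Bs, -(1 / 2) * ⟪Qpp b, a (Qpp b)⟫_ℝ - (1 / 2) * ⟪b, Δj b⟫_ℝ =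
      -(1 / 2) * ⟪b, (Qpps ∘ₗ a ∘ₗ Qpp + Δj) b⟫_ℝ := by
    intro b
    rw [← form_2120 Qpp Qpps a Δj hQpp b]
    ring
  have hf1 : (fun m => Real.exp (-(1 / 2) * ⟪Qpp (ιB m), a (Qpp (ιB m))⟫_ℝ - (1 / 2) * ⟪ιB m, Δj (ιB m)⟫_ℝ
      + ⟪ιB m, K⟫_ℝ)) = fun m => Real.exp (-(1 / 2) * ⟪ιB m, (Qpps ∘ₗ a ∘ₗ Qpp + Δj) (ιB m)⟫_ℝ + ⟪ιB m, K⟫_ℝ) := by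
    funext m
    rw [hpt]
  have hf2 : (fun m => Real.exp (-(1 / 2) * ⟪Qpp (ιB m), a (Qpp (ιB m))⟫_ℝ - (1 / 2) * ⟪ιB m, Δj (ιB m)⟫_ℝ)) =
      fun m => Real.exp (-(1 / 2) * ⟪ιB m, (Qpps ∘ₗ a ∘ₗ Qpp + Δj) (ιB m)⟫_ℝ) := by
    funext m
    rw [hpt]
  rw [hf1, hf2]
  exact B6Eq295.eq2115 ν ιB (Qpps ∘ₗ a ∘ₗ Qpp + Δj) Ct TB (form_2120_symm Qpp Qpps a Δj hQpp ha hΔj) hCt hCsol K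

end BIntegral

/-! ## §2 (2.129): the two-scale representation, from (2.119) and from (2.112) -/

section Repr

variable {A : Type*} [NormedAddCommGroup A] [InnerProductSpace ℝ A]
variable {W : Type*} [NormedAddCommGroup W] [InnerProductSpace ℝ W]
variable {N : Type*} [AddCommGroup N] [Module ℝ N] [MeasurableSpace N] [MeasurableAdd N]
variable {Bs : Type*} [NormedAddCommGroup Bs] [InnerProductSpace ℝ Bs]
variable {V : Type*} [NormedAddCommGroup V] [InnerProductSpace ℝ V]
variable {NB : Type*} [AddCommGroup NB] [Module ℝ NB] [MeasurableSpace NB] [MeasurableAdd NB]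

omit [MeasurableAdd NB] in
/-- **The normalisation hidden in (2.119).**  If (2.119) holds for every source `J` (with some constant `Z″⁻¹`), its
`J = 0` instance reads `Z″⁻¹ · ∫dB Π_{y∈Λ′}δ_{Ax(y)}(B) exp[−½⟨Q″B,aQ″B⟩ − ½⟨B,Δ_jB⟩] = 1`.
[cite: Balaban1984PropagatorsII, (2.119) p.243 + (2.129) p.246] -/
theorem normalisation_2119 (ν : Measure NB) (ιB : NB →ₗ[ℝ] Bs) (Qpp : Bs →ₗ[ℝ] V) (a : V →ₗ[ℝ] V)
    (Δj : Bs →ₗ[ℝ] Bs) (G K₁ K₂ Gt : A →ₗ[ℝ] A) (Hjs : A →ₗ[ℝ] Bs) (Zinv : ℝ)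
    (h2119 : ∀ J : A, Real.exp ((1 / 2) * ⟪J, G J⟫_ℝ) =
      Real.exp ((1 / 2) * ⟪J, K₁ J⟫_ℝ + (1 / 2) * ⟪J - K₂ J, Gt (J - K₂ J)⟫_ℝ) * Zinv *
        ∫ m, Real.exp (-(1 / 2) * ⟪Qpp (ιB m), a (Qpp (ιB m))⟫_ℝ - (1 / 2) * ⟪ιB m, Δj (ιB m)⟫_ℝ
          + ⟪ιB m, Hjs (J - K₂ J)⟫_ℝ) ∂ν) :
    Zinv * ∫ m, Real.exp (-(1 / 2) * ⟪Qpp (ιB m), a (Qpp (ιB m))⟫_ℝ - (1 / 2) * ⟪ιB m, Δj (ιB m)⟫_ℝ) ∂ν = 1 := by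
  have h0 := h2119 0
  simp only [map_zero, sub_self, inner_zero_right, mul_zero, add_zero, Real.exp_zero, one_mul] at h0
  exact h0.symm

/-- **(2.119) ⇒ (2.129)** (*"We may calculate the integral in (2.119), and we get finally the desired identity"*, p. 246).
Hypotheses: (2.119) for every source `J` (`h2119`, constant `Z″⁻¹ = Zinv`; `K₁ = ∂H′_jC^{(j)}_ΛH′_j*∂*`,
`K₂ = ∂ΔH′_jC^{(j)}_ΛH′_j*∂*`, `G̃_j = Gt`, `H_j*` the adjoint of `H_j` (`hadj`)); the B-integral data of `integral_2119`
(`ι_B`, `ν`, `Q″`/`Q″*`, `a`, `Δ_j`, the covariance `C̃^{(j)}_Λ = Ct`).  Conclusion, AS PRINTED: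
`⟨J, GJ⟩ = ⟨J, K₁J⟩ + ⟨J − K₂J, (G̃_j + H_jC̃^{(j)}_ΛH_j*)(J − K₂J)⟩` — the B-integral contributes
`e^{½⟨H_j*K, C̃H_j*K⟩}` times its value at `K = 0`, the constants are `1` by the `J = 0` instance, and `exp` is injective.
[cite: Balaban1984PropagatorsII, (2.129) p.246] -/
theorem eq2129_of_2119 (ν : Measure NB) [ν.IsAddLeftInvariant] (ιB : NB →ₗ[ℝ] Bs) (TB : Bs →ₗ[ℝ] NB)
    (Qpp : Bs →ₗ[ℝ] V) (Qpps : V →ₗ[ℝ] Bs) (a : V →ₗ[ℝ] V) (Δj Ct : Bs →ₗ[ℝ] Bs)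
    (hQpp : ∀ (w : V) (b : Bs), ⟪Qpps w, b⟫_ℝ = ⟪w, Qpp b⟫_ℝ) (ha : ∀ x y : V, ⟪a x, y⟫_ℝ = ⟪x, a y⟫_ℝ)
    (hΔj : ∀ x y : Bs, ⟪Δj x, y⟫_ℝ = ⟪x, Δj y⟫_ℝ) (hCt : ∀ K, Ct K = ιB (TB K))
    (hCsol : ∀ (m : NB) (K : Bs), ⟪ιB m, (Qpps ∘ₗ a ∘ₗ Qpp + Δj) (Ct K)⟫_ℝ = ⟪ιB m, K⟫_ℝ)
    (G K₁ K₂ Gt : A →ₗ[ℝ] A) (Hj : Bs →ₗ[ℝ] A) (Hjs : A →ₗ[ℝ] Bs)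
    (hadj : ∀ (b : Bs) (x : A), ⟪Hj b, x⟫_ℝ = ⟪b, Hjs x⟫_ℝ) (Zinv : ℝ)
    (h2119 : ∀ J : A, Real.exp ((1 / 2) * ⟪J, G J⟫_ℝ) =
      Real.exp ((1 / 2) * ⟪J, K₁ J⟫_ℝ + (1 / 2) * ⟪J - K₂ J, Gt (J - K₂ J)⟫_ℝ) * Zinv *
        ∫ m, Real.exp (-(1 / 2) * ⟪Qpp (ιB m), a (Qpp (ιB m))⟫_ℝ - (1 / 2) * ⟪ιB m, Δj (ιB m)⟫_ℝ
          + ⟪ιB m, Hjs (J - K₂ J)⟫_ℝ) ∂ν) (J : A) :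
    ⟪J, G J⟫_ℝ = ⟪J, K₁ J⟫_ℝ + ⟪J - K₂ J, (Gt + Hj ∘ₗ Ct ∘ₗ Hjs) (J - K₂ J)⟫_ℝ := by
  have hZ := normalisation_2119 ν ιB Qpp a Δj G K₁ K₂ Gt Hjs Zinv h2119
  have hJ := h2119 J
  rw [integral_2119 ν ιB TB Qpp Qpps a Δj Ct hQpp ha hΔj hCt hCsol (Hjs (J - K₂ J))] at hJ
  have hJ' : Real.exp ((1 / 2) * ⟪J, G J⟫_ℝ) =
      Real.exp ((1 / 2) * ⟪J, K₁ J⟫_ℝ + (1 / 2) * ⟪J - K₂ J, Gt (J - K₂ J)⟫_ℝ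
        + (1 / 2) * ⟪Hjs (J - K₂ J), Ct (Hjs (J - K₂ J))⟫_ℝ) := by
    rw [hJ, Real.exp_add ((1 / 2) * ⟪J, K₁ J⟫_ℝ + (1 / 2) * ⟪J - K₂ J, Gt (J - K₂ J)⟫_ℝ)
      ((1 / 2) * ⟪Hjs (J - K₂ J), Ct (Hjs (J - K₂ J))⟫_ℝ)]
    calc Real.exp ((1 / 2) * ⟪J, K₁ J⟫_ℝ + (1 / 2) * ⟪J - K₂ J, Gt (J - K₂ J)⟫_ℝ) * Zinv *
          (Real.exp ((1 / 2) * ⟪Hjs (J - K₂ J), Ct (Hjs (J - K₂ J))⟫_ℝ) *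
            ∫ m, Real.exp (-(1 / 2) * ⟪Qpp (ιB m), a (Qpp (ιB m))⟫_ℝ - (1 / 2) * ⟪ιB m, Δj (ιB m)⟫_ℝ) ∂ν)
        = Real.exp ((1 / 2) * ⟪J, K₁ J⟫_ℝ + (1 / 2) * ⟪J - K₂ J, Gt (J - K₂ J)⟫_ℝ) *
          Real.exp ((1 / 2) * ⟪Hjs (J - K₂ J), Ct (Hjs (J - K₂ J))⟫_ℝ) *
            (Zinv * ∫ m, Real.exp (-(1 / 2) * ⟪Qpp (ιB m), a (Qpp (ιB m))⟫_ℝ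
              - (1 / 2) * ⟪ιB m, Δj (ιB m)⟫_ℝ) ∂ν) := by ring
      _ = Real.exp ((1 / 2) * ⟪J, K₁ J⟫_ℝ + (1 / 2) * ⟪J - K₂ J, Gt (J - K₂ J)⟫_ℝ) *
          Real.exp ((1 / 2) * ⟪Hjs (J - K₂ J), Ct (Hjs (J - K₂ J))⟫_ℝ) := by rw [hZ, mul_one]
  have hlog := Real.exp_injective hJ'
  have hHC : ⟪Hjs (J - K₂ J), Ct (Hjs (J - K₂ J))⟫_ℝ = ⟪J - K₂ J, Hj (Ct (Hjs (J - K₂ J)))⟫_ℝ := by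
    rw [real_inner_comm, ← hadj, real_inner_comm]
  simp only [LinearMap.add_apply, LinearMap.coe_comp, Function.comp_apply, inner_add_right, ← hHC]
  linarith

/-- **(2.129) p. 246, AS PRINTED, from (2.112):** under the hypotheses of `…B6GaussianIdentity2119.eq2119` (the
(2.113)–(2.118) data: `M = Δ − ∂P_j∂*` symmetric, `ι`/`μ` coordinates of `{Q_jA = 0}`, `H_j` with `hcrit`, `H_j*` its
adjoint, `G̃_j = ι∘T` with `hsol`, the identification (2.116)–(2.118) `h2118`), the B-integral data of `integral_2119`,
and (2.112) displayed for every source `J` (`h2112`, constant `c = Z⁻¹Z′_j⁻¹Z′`):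
*"⟨J, GJ⟩ = ⟨J, ∂H′_jC^{(j)}_ΛH′_j*∂*J⟩ + ⟨J − ∂ΔH′_jC^{(j)}_ΛH′_j*∂*J, (G̃_j + H_jC̃^{(j)}_ΛH_j*)(J − ∂ΔH′_jC^{(j)}_ΛH′_j*∂*J)⟩. (2.129)"*
[cite: Balaban1984PropagatorsII, (2.129) p.246] -/
theorem eq2129 (μ : Measure N) [μ.IsAddLeftInvariant] (ι : N →ₗ[ℝ] A) (M Gt : A →ₗ[ℝ] A)
    (T : A →ₗ[ℝ] N) (Q : A →ₗ[ℝ] W) (Hj : Bs →ₗ[ℝ] A) (Hjs : A →ₗ[ℝ] Bs) (Δj : Bs →ₗ[ℝ] Bs)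
    (hM : ∀ x y : A, ⟪M x, y⟫_ℝ = ⟪x, M y⟫_ℝ) (hι : ∀ n, Q (ι n) = 0)
    (hcrit : ∀ (b : Bs) (v : A), Q v = 0 → ⟪v, M (Hj b)⟫_ℝ = 0)
    (hGt : ∀ J, Gt J = ι (T J)) (hsol : ∀ (n : N) (J : A), ⟪ι n, M (Gt J)⟫_ℝ = ⟪ι n, J⟫_ℝ)
    (hadj : ∀ (b : Bs) (x : A), ⟪Hj b, x⟫_ℝ = ⟪b, Hjs x⟫_ℝ)
    (h2118 : ∀ b : Bs, ⟪Hj b, M (Hj b)⟫_ℝ = ⟪b, Δj b⟫_ℝ)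
    (ν : Measure NB) [ν.IsAddLeftInvariant] (ιB : NB →ₗ[ℝ] Bs) (TB : Bs →ₗ[ℝ] NB)
    (Qpp : Bs →ₗ[ℝ] V) (Qpps : V →ₗ[ℝ] Bs) (a : V →ₗ[ℝ] V) (Ct : Bs →ₗ[ℝ] Bs)
    (hQpp : ∀ (w : V) (b : Bs), ⟪Qpps w, b⟫_ℝ = ⟪w, Qpp b⟫_ℝ) (ha : ∀ x y : V, ⟪a x, y⟫_ℝ = ⟪x, a y⟫_ℝ)
    (hΔj : ∀ x y : Bs, ⟪Δj x, y⟫_ℝ = ⟪x, Δj y⟫_ℝ) (hCt : ∀ K, Ct K = ιB (TB K))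
    (hCsol : ∀ (m : NB) (K : Bs), ⟪ιB m, (Qpps ∘ₗ a ∘ₗ Qpp + Δj) (Ct K)⟫_ℝ = ⟪ιB m, K⟫_ℝ)
    (G K₁ K₂ : A →ₗ[ℝ] A) (c : ℝ)
    (h2112 : ∀ J : A, Real.exp ((1 / 2) * ⟪J, G J⟫_ℝ) = Real.exp ((1 / 2) * ⟪J, K₁ J⟫_ℝ) * c *
      ∫ m, Real.exp (-(1 / 2) * ⟪Qpp (ιB m), a (Qpp (ιB m))⟫_ℝ) *
        (∫ n, Real.exp (-(1 / 2) * ⟪ι n + Hj (ιB m), M (ι n + Hj (ιB m))⟫_ℝ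
          + ⟪ι n + Hj (ιB m), J - K₂ J⟫_ℝ) ∂μ) ∂ν)
    (J : A) :
    ⟪J, G J⟫_ℝ = ⟪J, K₁ J⟫_ℝ + ⟪J - K₂ J, (Gt + Hj ∘ₗ Ct ∘ₗ Hjs) (J - K₂ J)⟫_ℝ :=
  eq2129_of_2119 ν ιB TB Qpp Qpps a Δj Ct hQpp ha hΔj hCt hCsol G K₁ K₂ Gt Hj Hjs hadj
    (c * ∫ n, Real.exp (-(1 / 2) * ⟪ι n, M (ι n)⟫_ℝ) ∂μ)
    (fun J' => B6GaussianIdentity2119.eq2119 μ ι M Gt T Q Hj Hjs Δj hM hι hcrit hGt hsol hadj h2118 ν ιB Qpp a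
      K₁ K₂ J' _ c (h2112 J')) J

/-- **(2.129) with THE printed operators (2.130)–(2.131):** as `eq2129`, with `H_j := G_jQ_j*(Q_jG_jQ_j*)⁻¹` and
`G̃_j := G_j − G_jQ_j*(Q_jG_jQ_j*)⁻¹Q_jG_j` (`G_j` a right inverse of `(Δ − ∂P_j∂*) + Q_j*a₁Q_j`, `E` a right inverse of
`Q_jG_jQ_j*`, `Q_j*` the adjoint of `Q_j`; the `B` of `δ(Q_jA − B)` is a `Q_j`-field, so here the B-fields ARE the
`Q_j`-fields `W`): the hypotheses `hcrit` and `hsol` of `eq2129` are now THEOREMS (`hOp_crit`, `tildeOp_sol`); of `G̃_j`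
only its coordinate expression `G̃_j = ι∘T` in the chosen coordinates `ι` of `{Q_jA = 0}` remains (`Q_jG̃_j = 0`,
`Q_tildeOp`, makes such a `T` exist for any linear bijection `ι` onto `{Q_jA = 0}`).  (`a₁` on the `Q_j`-fields and `a`
on the `Q″`-fields are print's one number `a`.) [cite: Balaban1984PropagatorsII, (2.129)–(2.131) p.246] -/
theorem eq2129_printed (μ : Measure N) [μ.IsAddLeftInvariant] (ι : N →ₗ[ℝ] A) (T : A →ₗ[ℝ] N)
    (M Gj : A →ₗ[ℝ] A) (Q : A →ₗ[ℝ] W) (Qs : W →ₗ[ℝ] A) (a₁ E : W →ₗ[ℝ] W) (Hjs : A →ₗ[ℝ] W)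
    (Δj : W →ₗ[ℝ] W)
    (hM : ∀ x y : A, ⟪M x, y⟫_ℝ = ⟪x, M y⟫_ℝ) (hQ : ∀ (w : W) (v : A), ⟪Qs w, v⟫_ℝ = ⟪w, Q v⟫_ℝ)
    (hGj : (M + Qs ∘ₗ a₁ ∘ₗ Q) ∘ₗ Gj = LinearMap.id) (hE : (Q ∘ₗ Gj ∘ₗ Qs) ∘ₗ E = LinearMap.id)
    (hι : ∀ n, Q (ι n) = 0) (hT : ∀ J, B6SectA.tildeOp Gj Q Qs E J = ι (T J))
    (hadj : ∀ (b : W) (x : A), ⟪B6SectA.hOp Gj Qs E b, x⟫_ℝ = ⟪b, Hjs x⟫_ℝ)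
    (h2118 : ∀ b : W, ⟪B6SectA.hOp Gj Qs E b, M (B6SectA.hOp Gj Qs E b)⟫_ℝ = ⟪b, Δj b⟫_ℝ)
    (ν : Measure NB) [ν.IsAddLeftInvariant] (ιB : NB →ₗ[ℝ] W) (TB : W →ₗ[ℝ] NB)
    (Qpp : W →ₗ[ℝ] V) (Qpps : V →ₗ[ℝ] W) (a : V →ₗ[ℝ] V) (Ct : W →ₗ[ℝ] W)
    (hQpp : ∀ (w : V) (b : W), ⟪Qpps w, b⟫_ℝ = ⟪w, Qpp b⟫_ℝ) (ha : ∀ x y : V, ⟪a x, y⟫_ℝ = ⟪x, a y⟫_ℝ)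
    (hΔj : ∀ x y : W, ⟪Δj x, y⟫_ℝ = ⟪x, Δj y⟫_ℝ) (hCt : ∀ K, Ct K = ιB (TB K))
    (hCsol : ∀ (m : NB) (K : W), ⟪ιB m, (Qpps ∘ₗ a ∘ₗ Qpp + Δj) (Ct K)⟫_ℝ = ⟪ιB m, K⟫_ℝ)
    (G K₁ K₂ : A →ₗ[ℝ] A) (c : ℝ)
    (h2112 : ∀ J : A, Real.exp ((1 / 2) * ⟪J, G J⟫_ℝ) = Real.exp ((1 / 2) * ⟪J, K₁ J⟫_ℝ) * c *
      ∫ m, Real.exp (-(1 / 2) * ⟪Qpp (ιB m), a (Qpp (ιB m))⟫_ℝ) *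
        (∫ n, Real.exp (-(1 / 2) * ⟪ι n + B6SectA.hOp Gj Qs E (ιB m), M (ι n + B6SectA.hOp Gj Qs E (ιB m))⟫_ℝ
          + ⟪ι n + B6SectA.hOp Gj Qs E (ιB m), J - K₂ J⟫_ℝ) ∂μ) ∂ν)
    (J : A) :
    ⟪J, G J⟫_ℝ = ⟪J, K₁ J⟫_ℝ + ⟪J - K₂ J,
      (B6SectA.tildeOp Gj Q Qs E + B6SectA.hOp Gj Qs E ∘ₗ Ct ∘ₗ Hjs) (J - K₂ J)⟫_ℝ :=
  eq2129 μ ι M (B6SectA.tildeOp Gj Q Qs E) T Q (B6SectA.hOp Gj Qs E) Hjs Δj hM hι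
    (fun b v hv => B6Eq2130.hOp_crit M Gj Q Qs a₁ E hQ hGj hE b v hv) hT
    (fun n J' => B6Eq2130.tildeOp_sol M Gj Q Qs a₁ E hQ hGj (ι n) J' (hι n)) hadj h2118
    ν ιB TB Qpp Qpps a Ct hQpp ha hΔj hCt hCsol G K₁ K₂ c h2112 J

end Repr

/-! ## §3 p. 246: "the forms are bounded from below by γ₀″‖B‖² … This implies that a covariance C̃^{(j)}_Λ of the
Gaussian integral in (2.119) is bounded from above by a positive constant dependent on d and L only" -/

section CovarianceBound

variable {Bs : Type*} [NormedAddCommGroup Bs] [InnerProductSpace ℝ Bs]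
variable {NB : Type*} [AddCommGroup NB] [Module ℝ NB]

/-- For a covariance `C̃` (range in the constraint configurations `ι_B(NB)`, inverting the form `M_B` there) of a form
bounded below by `γ‖B‖²` on those configurations: `γ‖C̃K‖² ≤ ⟨C̃K, K⟩`. [cite: Balaban1984PropagatorsII, p.246 before (2.129)] -/
theorem cov_coercive (ιB : NB →ₗ[ℝ] Bs) (TB : Bs →ₗ[ℝ] NB) (MB Ct : Bs →ₗ[ℝ] Bs) (γ : ℝ)
    (hcoer : ∀ m : NB, γ * ‖ιB m‖ ^ 2 ≤ ⟪ιB m, MB (ιB m)⟫_ℝ) (hCt : ∀ K, Ct K = ιB (TB K))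
    (hCsol : ∀ (m : NB) (K : Bs), ⟪ιB m, MB (Ct K)⟫_ℝ = ⟪ιB m, K⟫_ℝ) (K : Bs) :
    γ * ‖Ct K‖ ^ 2 ≤ ⟪Ct K, K⟫_ℝ := by
  have hsol' : ⟪Ct K, MB (Ct K)⟫_ℝ = ⟪Ct K, K⟫_ℝ := by
    have := hCsol (TB K) K
    rwa [← hCt] at this
  have hco' : γ * ‖Ct K‖ ^ 2 ≤ ⟪Ct K, MB (Ct K)⟫_ℝ := by
    have := hcoer (TB K)
    rwa [← hCt] at this
  exact hco'.trans_eq hsol'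

/-- **p. 246: the form `≥ γ‖B‖²` on the constraint configurations (print: `γ = γ₀″(d, L)`) implies the covariance is
bounded from above:** `‖C̃^{(j)}_ΛK‖ ≤ γ⁻¹‖K‖`. [cite: Balaban1984PropagatorsII, p.246 before (2.129)] -/
theorem norm_cov_le (ιB : NB →ₗ[ℝ] Bs) (TB : Bs →ₗ[ℝ] NB) (MB Ct : Bs →ₗ[ℝ] Bs) (γ : ℝ) (hγ : 0 < γ)
    (hcoer : ∀ m : NB, γ * ‖ιB m‖ ^ 2 ≤ ⟪ιB m, MB (ιB m)⟫_ℝ) (hCt : ∀ K, Ct K = ιB (TB K))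
    (hCsol : ∀ (m : NB) (K : Bs), ⟪ιB m, MB (Ct K)⟫_ℝ = ⟪ιB m, K⟫_ℝ) (K : Bs) :
    ‖Ct K‖ ≤ γ⁻¹ * ‖K‖ := by
  have h1 : γ * ‖Ct K‖ ^ 2 ≤ ‖Ct K‖ * ‖K‖ :=
    (cov_coercive ιB TB MB Ct γ hcoer hCt hCsol K).trans (real_inner_le_norm _ _)
  have h2 : γ * ‖Ct K‖ ≤ ‖K‖ := by
    by_cases h0 : ‖Ct K‖ = 0
    · rw [h0, mul_zero]; exact norm_nonneg _
    · have hpos : 0 < ‖Ct K‖ := lt_of_le_of_ne (norm_nonneg _) (Ne.symm h0)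
      nlinarith [h1, hpos, norm_nonneg K]
  have h3 := mul_le_mul_of_nonneg_left h2 (inv_nonneg.mpr hγ.le)
  rwa [← mul_assoc, inv_mul_cancel₀ hγ.ne', one_mul] at h3

/-- The covariance is a non-negative form: `0 ≤ ⟨K, C̃K⟩` (for `γ ≥ 0`). [cite: Balaban1984PropagatorsII, p.246 before (2.129)] -/
theorem inner_cov_nonneg (ιB : NB →ₗ[ℝ] Bs) (TB : Bs →ₗ[ℝ] NB) (MB Ct : Bs →ₗ[ℝ] Bs) (γ : ℝ) (hγ : 0 ≤ γ)
    (hcoer : ∀ m : NB, γ * ‖ιB m‖ ^ 2 ≤ ⟪ιB m, MB (ιB m)⟫_ℝ) (hCt : ∀ K, Ct K = ιB (TB K))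
    (hCsol : ∀ (m : NB) (K : Bs), ⟪ιB m, MB (Ct K)⟫_ℝ = ⟪ιB m, K⟫_ℝ) (K : Bs) :
    0 ≤ ⟪K, Ct K⟫_ℝ := by
  rw [real_inner_comm]
  exact (mul_nonneg hγ (sq_nonneg _)).trans (cov_coercive ιB TB MB Ct γ hcoer hCt hCsol K)

/-- **p. 246, as a bound on the form of the covariance:** `⟨K, C̃^{(j)}_ΛK⟩ ≤ γ⁻¹‖K‖²` — *"a covariance C̃^{(j)}_Λ of the
Gaussian integral in (2.119) is bounded from above by a positive constant dependent on d and L only"* (the constant being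
`γ₀″⁻¹`). [cite: Balaban1984PropagatorsII, p.246 before (2.129)] -/
theorem inner_cov_le (ιB : NB →ₗ[ℝ] Bs) (TB : Bs →ₗ[ℝ] NB) (MB Ct : Bs →ₗ[ℝ] Bs) (γ : ℝ) (hγ : 0 < γ)
    (hcoer : ∀ m : NB, γ * ‖ιB m‖ ^ 2 ≤ ⟪ιB m, MB (ιB m)⟫_ℝ) (hCt : ∀ K, Ct K = ιB (TB K))
    (hCsol : ∀ (m : NB) (K : Bs), ⟪ιB m, MB (Ct K)⟫_ℝ = ⟪ιB m, K⟫_ℝ) (K : Bs) :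
    ⟪K, Ct K⟫_ℝ ≤ γ⁻¹ * ‖K‖ ^ 2 := by
  calc ⟪K, Ct K⟫_ℝ ≤ ‖K‖ * ‖Ct K‖ := real_inner_le_norm _ _
    _ ≤ ‖K‖ * (γ⁻¹ * ‖K‖) :=
        mul_le_mul_of_nonneg_left (norm_cov_le ιB TB MB Ct γ hγ hcoer hCt hCsol K) (norm_nonneg _)
    _ = γ⁻¹ * ‖K‖ ^ 2 := by ring

end CovarianceBound

end Literature.MathematicalPhysics.QuantumFieldTheory.Balaban1983to89.B6Repr2129

end
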